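import Literature.NumberTheory.LFunctions.ZetaArgVariation
import Mathlib.Analysis.Complex.ExponentialBounds
import HarnessLib

/-!
# Zeros of `ζ` in unit windows and window sums of the Cauchy kernel over the ordinates

Trunk T-ANT (`Literature/NumberTheory/LFunctions`). Proofs only (no definitions, no named
facts). Bookkeeping input of the `L²`-identity (P2)
`Literature.NumberTheory.LFunctions.montgomery_pairSum_eq_meanSquare` in Montgomery's proof of
his pair correlation theorem (Montgomery 1973, §3; Goldston 2005, §4): the only property of the
zeros used there is (Goldston 2005, (2.18)) "`N(T+1) − N(T) = ∑_{T<γ≤T+1} 1 ≪ log T`", from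
which, for `0 ≤ t ≤ T`, `∑_{γ ∉ (0,T]} 1/(1+(t−γ)²) ≪ (1/(t+1) + 1/(T−t+1)) log T` and
`∑_γ 1/(1+(t−γ)²) ≪ log T` (grouping the zeros into unit windows).

Everything is written with the tree's enumeration `γ_n = zetaOrdinate n` of the positive
ordinates (0-indexed, non-decreasing, with multiplicity) and its counting function
`N(T) = zetaZeroCount T`; the dictionary `γ_n ≤ T ↔ n + 1 ≤ N(T)`
(`riemann_von_mangoldt.zetaOrdinate_le_iff`) and the window count are consequences of the
Riemann–von Mangoldt formula, a theorem of the tree (`riemann_von_mangoldt_holds`).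

## Main results

* `Montgomery.exists_zetaZeroCount_window_le` : `N(u+1) − N(u) ≤ C₀ log(|u|+2)` for all real `u`.
* `Montgomery.sum_above_le`, `Montgomery.sum_below_le` : for a finite set of indices with
  `γ_n > u₀` (resp. `γ_n ≤ u₀`), `∑ 1/(1+(γ_n−u₀+d)²) ≪ (log(u₀+2) + log(d+2))/(d+1)`
  (resp. `∑ 1/(1+(u₀−γ_n+d)²) ≪ log(u₀+2)/(d+1)`), with explicit constants.
* `Montgomery.sum_range_kernel_le_of_mem_Icc` (`0 ≤ t ≤ T`: `∑_{0<γ≤T} 1/(1+(t−γ)²) ≤ 24C₀ log(T+2)`),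
  `Montgomery.tsum_kernel_shift_le`, `Montgomery.tsum_kernel_neg_le` (the zeros `γ > T` and the
  negative ordinates: `≤ 16C₀ log(T+2)/(T−t+1)`, `≤ 16C₀ log(T+2)/(t+1)`),
  `Montgomery.sum_range_kernel_le_of_le` (`t ≥ T`), `Montgomery.sum_range_kernel_le_of_nonpos` (`t ≤ 0`).
* Tools: `Montgomery.sum_range_one_div_one_add_sq_le` (`∑_k 1/(1+(k+d)²) ≤ 4/(d+1)`),
  `Montgomery.sum_range_log_div_one_add_sq_le` (`∑_k log(k+1)/(1+(k+d)²) ≤ 12 log(d+2)/(d+1)`).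

## References

* D. A. Goldston, *Notes on pair correlation of zeros and prime numbers*, LMS Lecture Note
  Ser. 322 (2005), (2.18) and §4.
* H. L. Montgomery, *The pair correlation of zeros of the zeta function*, Proc. Sympos. Pure
  Math. 24 (1973), 181–193, §3.
* E. C. Titchmarsh, *The Theory of the Riemann Zeta-Function*, 2nd ed. (1986), §9.1, Thm. 9.2.
-/

noncomputable section

open Real Filter Set Asymptotics
open scoped Topology

namespace Literature.NumberTheory.LFunctions

namespace Montgomery

/-! ## Two real-series lemmas -/

/-- Telescoping form of `∑_{k<K} 1/(1+(k+d)²) ≤ 4/(d+1)`: the partial sums are at most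
`4/(d+1) - 4/(K+d+1)` (`1/(1+y²) ≤ 4/((y+1)(y+2))` for `y ≥ 0`). [folklore] -/
theorem sum_range_one_div_one_add_sq_le_sub {d : ℝ} (hd : 0 ≤ d) (K : ℕ) :
    ∑ k ∈ Finset.range K, 1 / (1 + ((k : ℝ) + d) ^ 2) ≤ 4 / (d + 1) - 4 / ((K : ℝ) + d + 1) := by
  induction K with
  | zero => simp
  | succ K ih =>
    rw [Finset.sum_range_succ]
    have hy : (0 : ℝ) ≤ (K : ℝ) + d := by positivity
    have step : 1 / (1 + ((K : ℝ) + d) ^ 2) ≤ 4 / ((K : ℝ) + d + 1) - 4 / ((K : ℝ) + d + 2) := by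
      rw [div_sub_div _ _ (by positivity) (by positivity),
        div_le_div_iff₀ (by positivity) (by positivity)]
      nlinarith [sq_nonneg ((K : ℝ) + d - 1 / 2)]
    have hcast : ((K + 1 : ℕ) : ℝ) + d + 1 = (K : ℝ) + d + 2 := by push_cast; ring
    rw [hcast]
    linarith

/-- `∑_{k<K} 1/(1+(k+d)²) ≤ 4/(d+1)` for `d ≥ 0`, uniformly in `K`. [folklore] -/
theorem sum_range_one_div_one_add_sq_le {d : ℝ} (hd : 0 ≤ d) (K : ℕ) :
    ∑ k ∈ Finset.range K, 1 / (1 + ((k : ℝ) + d) ^ 2) ≤ 4 / (d + 1) := by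
  have h := sum_range_one_div_one_add_sq_le_sub hd K
  have : (0 : ℝ) ≤ 4 / ((K : ℝ) + d + 1) := by positivity
  linarith

/-- The telescoping inequality behind `∑ log(k+1)/(1+(k+d)²) ≪ log(d+2)/(d+1)`: with
`g(y) = (1 + log y)/y`, `g(y) - g(y+1) ≥ log y/(y(y+1))` for `y ≥ 1` (equivalent to
`log(1 + 1/y) ≤ 1/y`). [folklore] -/
theorem log_div_mul_le_sub {y : ℝ} (hy : 1 ≤ y) :
    Real.log y / (y * (y + 1)) ≤ (1 + Real.log y) / y - (1 + Real.log (y + 1)) / (y + 1) := by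
  have hy0 : 0 < y := by linarith
  have hkey : y * (Real.log (y + 1) - Real.log y) ≤ 1 := by
    have h1 : Real.log ((y + 1) / y) ≤ (y + 1) / y - 1 := Real.log_le_sub_one_of_pos (by positivity)
    rw [Real.log_div (by positivity) hy0.ne'] at h1
    have h2 : (y + 1) / y - 1 = 1 / y := by field_simp; ring
    rw [h2] at h1
    calc y * (Real.log (y + 1) - Real.log y) ≤ y * (1 / y) :=
          mul_le_mul_of_nonneg_left h1 hy0.le
      _ = 1 := by field_simp
  rw [div_sub_div _ _ hy0.ne' (by positivity), div_le_div_iff₀ (by positivity) (by positivity)]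
  nlinarith [Real.log_nonneg hy, mul_pos hy0 (by positivity : (0 : ℝ) < y + 1)]

/-- Telescoping form: `∑_{k<K} log(k+1)/(1+(k+d)²) ≤ 4 (g(d+1) - g(K+d+1))`,
`g(y) = (1 + log y)/y`, for `d ≥ 0`. [folklore] -/
theorem sum_range_log_div_one_add_sq_le_sub {d : ℝ} (hd : 0 ≤ d) (K : ℕ) :
    ∑ k ∈ Finset.range K, Real.log ((k : ℝ) + 1) / (1 + ((k : ℝ) + d) ^ 2) ≤
      4 * ((1 + Real.log (d + 1)) / (d + 1) -
        (1 + Real.log ((K : ℝ) + d + 1)) / ((K : ℝ) + d + 1)) := by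
  induction K with
  | zero => simp
  | succ K ih =>
    rw [Finset.sum_range_succ]
    set y : ℝ := (K : ℝ) + d + 1 with hy_def
    have hy1 : 1 ≤ y := by rw [hy_def]; linarith [K.cast_nonneg (α := ℝ)]
    have hy0 : 0 < y := by linarith
    -- the new term is at most `2 log y / y²`
    have hlogK : Real.log ((K : ℝ) + 1) ≤ Real.log y :=
      Real.log_le_log (by positivity) (by rw [hy_def]; linarith)
    have hlog0 : 0 ≤ Real.log ((K : ℝ) + 1) := Real.log_nonneg (by linarith [K.cast_nonneg (α := ℝ)])
    have hden : 1 / (1 + ((K : ℝ) + d) ^ 2) ≤ 2 / y ^ 2 := by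
      rw [div_le_div_iff₀ (by positivity) (by positivity)]
      have : ((K : ℝ) + d) = y - 1 := by rw [hy_def]; ring
      rw [this]
      nlinarith [sq_nonneg (y - 2)]
    have hterm : Real.log ((K : ℝ) + 1) / (1 + ((K : ℝ) + d) ^ 2) ≤ 2 * (Real.log y / y ^ 2) := by
      rw [div_eq_mul_one_div]
      calc Real.log ((K : ℝ) + 1) * (1 / (1 + ((K : ℝ) + d) ^ 2))
          ≤ Real.log y * (2 / y ^ 2) := mul_le_mul hlogK hden (by positivity) (Real.log_nonneg hy1)
        _ = 2 * (Real.log y / y ^ 2) := by ring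
    -- and `2 log y / y² ≤ 4 (g y - g (y+1))`
    have htel := log_div_mul_le_sub hy1
    have hcmp : Real.log y / y ^ 2 ≤ 2 * (Real.log y / (y * (y + 1))) := by
      rw [div_le_iff₀ (by positivity)]
      have hlogy : 0 ≤ Real.log y := Real.log_nonneg hy1
      have : 2 * (Real.log y / (y * (y + 1))) * y ^ 2 = Real.log y * (2 * y / (y + 1)) := by
        field_simp
      rw [this]
      refine le_mul_of_one_le_right hlogy ?_
      rw [le_div_iff₀ (by positivity)]; linarith
    have hcast : ((K + 1 : ℕ) : ℝ) + d + 1 = y + 1 := by push_cast; rw [hy_def]; ring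
    rw [hcast]
    linarith

/-- `∑_{k<K} log(k+1)/(1+(k+d)²) ≤ 12 log(d+2)/(d+1)` for `d ≥ 0`, uniformly in `K`. [folklore] -/
theorem sum_range_log_div_one_add_sq_le {d : ℝ} (hd : 0 ≤ d) (K : ℕ) :
    ∑ k ∈ Finset.range K, Real.log ((k : ℝ) + 1) / (1 + ((k : ℝ) + d) ^ 2) ≤
      12 * Real.log (d + 2) / (d + 1) := by
  refine (sum_range_log_div_one_add_sq_le_sub hd K).trans ?_
  have hK : 0 ≤ (1 + Real.log ((K : ℝ) + d + 1)) / ((K : ℝ) + d + 1) := by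
    have : 0 ≤ Real.log ((K : ℝ) + d + 1) := Real.log_nonneg (by linarith [K.cast_nonneg (α := ℝ)])
    positivity
  have hlog2 : (1 : ℝ) ≤ 2 * Real.log (d + 2) := by
    have h2 : Real.log 2 ≤ Real.log (d + 2) := Real.log_le_log (by norm_num) (by linarith)
    linarith [Real.log_two_gt_d9]
  have hmono : Real.log (d + 1) ≤ Real.log (d + 2) := Real.log_le_log (by positivity) (by linarith)
  have h3 : (1 + Real.log (d + 1)) / (d + 1) ≤ 3 * Real.log (d + 2) / (d + 1) := by
    gcongr; linarith
  have h4 : 12 * Real.log (d + 2) / (d + 1) = 4 * (3 * Real.log (d + 2) / (d + 1)) := by ring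
  rw [h4]
  linarith


/-! ## Zeros in unit windows -/

/-- **Zeros in a unit window** (Goldston 2005, (2.18): "`N(T+1) − N(T) = ∑_{T<γ≤T+1} 1 ≪ log T`";
Titchmarsh Thm. 9.2), here in the uniform form `N(u+1) − N(u) ≤ C₀ log(|u| + 2)` for all real
`u`, derived from the Riemann–von Mangoldt formula `riemann_von_mangoldt_holds` (for large `u`)
and the monotonicity of `N` (for bounded `u`). [cite: Goldston2005, (2.18)] -/
theorem exists_zetaZeroCount_window_le :
    ∃ C₀ : ℝ, 0 < C₀ ∧ ∀ u : ℝ,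
      (zetaZeroCount (u + 1) : ℝ) - zetaZeroCount u ≤ C₀ * Real.log (|u| + 2) := by
  have h := riemann_von_mangoldt_holds
  obtain ⟨c, hc, hbd⟩ := h.exists_pos
  obtain ⟨T₀, hT₀⟩ := eventually_atTop.1 hbd.bound
  set T₁ : ℝ := max T₀ 2 with hT₁
  set M : ℝ := (zetaZeroCount (T₁ + 1) : ℝ) with hM
  have hM0 : 0 ≤ M := by positivity
  refine ⟨2 * c + 3 + 2 * M, by positivity, fun u ↦ ?_⟩
  have hlog2 : (1 : ℝ) / 2 ≤ Real.log (|u| + 2) := by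
    have : Real.log 2 ≤ Real.log (|u| + 2) :=
      Real.log_le_log (by norm_num) (by linarith [abs_nonneg u])
    linarith [Real.log_two_gt_d9]
  have hlog0 : 0 ≤ Real.log (|u| + 2) := by linarith
  rcases lt_or_ge u T₁ with hu | hu
  · -- bounded `u`: `N(u+1) - N(u) ≤ N(T₁+1) = M ≤ 2M log(|u|+2)`
    have h1 : (zetaZeroCount (u + 1) : ℝ) ≤ M := by
      rw [hM]; exact_mod_cast zetaZeroCount_mono (by linarith)
    have h2 : (0 : ℝ) ≤ zetaZeroCount u := by positivity
    have h3 : M ≤ 2 * M * Real.log (|u| + 2) := by nlinarith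
    nlinarith [mul_nonneg (by positivity : (0 : ℝ) ≤ 2 * c + 3) hlog0]
  · -- large `u`: Riemann–von Mangoldt at `u` and `u + 1`
    have hu2 : 2 ≤ u := le_trans (le_max_right _ _) hu
    have huT₀ : T₀ ≤ u := le_trans (le_max_left _ _) hu
    have hb1 := hT₀ u huT₀
    have hb2 := hT₀ (u + 1) (by linarith)
    have hL₀ : 0 ≤ Real.log u := Real.log_nonneg (by linarith)
    have hL₁ : 0 ≤ Real.log (u + 1) := Real.log_nonneg (by linarith)
    rw [Real.norm_of_nonneg hL₀, Real.norm_eq_abs] at hb1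
    rw [Real.norm_of_nonneg hL₁, Real.norm_eq_abs] at hb2
    have hb1' := (abs_le.1 hb1).1
    have hb2' := (abs_le.1 hb2).2
    -- the main term increases by at most `log(u+1)` over `[u, u+1]`
    have hP : 0 ≤ Real.log (2 * π) := Real.log_nonneg (by linarith [pi_gt_three])
    have hkey : u * (Real.log (u + 1) - Real.log u) ≤ 1 := by
      have h1 : Real.log ((u + 1) / u) ≤ (u + 1) / u - 1 :=
        Real.log_le_sub_one_of_pos (by positivity)
      rw [Real.log_div (by positivity) (by positivity)] at h1
      have h2 : (u + 1) / u - 1 = 1 / u := by field_simp; ring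
      rw [h2] at h1
      calc u * (Real.log (u + 1) - Real.log u) ≤ u * (1 / u) :=
            mul_le_mul_of_nonneg_left h1 (by positivity)
        _ = 1 := by field_simp
    have hmain : ((u + 1) / (2 * π) * Real.log ((u + 1) / (2 * π)) - (u + 1) / (2 * π)) -
        (u / (2 * π) * Real.log (u / (2 * π)) - u / (2 * π)) ≤ Real.log (u + 1) := by
      rw [Real.log_div (by positivity) (by positivity), Real.log_div (by positivity) (by positivity)]
      have e : ((u + 1) / (2 * π) * (Real.log (u + 1) - Real.log (2 * π)) - (u + 1) / (2 * π)) -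
          (u / (2 * π) * (Real.log u - Real.log (2 * π)) - u / (2 * π)) =
          (Real.log (u + 1) + u * (Real.log (u + 1) - Real.log u) - Real.log (2 * π) - 1) /
            (2 * π) := by
        field_simp; ring
      rw [e, div_le_iff₀ (by positivity)]
      have : Real.log (u + 1) ≤ Real.log (u + 1) * (2 * π) :=
        le_mul_of_one_le_right hL₁ (by linarith [pi_gt_three])
      linarith
    have hlogu : Real.log u ≤ Real.log (|u| + 2) :=
      Real.log_le_log (by positivity) (by rw [abs_of_nonneg (by positivity)]; linarith)
    have hlogu1 : Real.log (u + 1) ≤ Real.log (|u| + 2) :=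
      Real.log_le_log (by positivity) (by rw [abs_of_nonneg (by positivity)]; linarith)
    have hc1 := mul_le_mul_of_nonneg_left hlogu hc.le
    have hc2 := mul_le_mul_of_nonneg_left hlogu1 hc.le
    have hM2 : 0 ≤ (2 + 2 * M) * Real.log (|u| + 2) := mul_nonneg (by positivity) hlog0
    nlinarith

/-- `t < γ_n ↔ N(t) ≤ n` (from `γ_n ≤ t ↔ n + 1 ≤ N(t)`, `riemann_von_mangoldt.zetaOrdinate_le_iff`
with `riemann_von_mangoldt_holds`). [cite: Titchmarsh1986, §9.1] -/
theorem lt_zetaOrdinate_iff {n : ℕ} {t : ℝ} : t < zetaOrdinate n ↔ zetaZeroCount t ≤ n := by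
  rw [← not_le, riemann_von_mangoldt_holds.zetaOrdinate_le_iff, not_le, Nat.lt_add_one_iff]

/-- `γ_n ≤ t ↔ n < N(t)`. [cite: Titchmarsh1986, §9.1] -/
theorem zetaOrdinate_le_iff_lt {n : ℕ} {t : ℝ} : zetaOrdinate n ≤ t ↔ n < zetaZeroCount t := by
  rw [riemann_von_mangoldt_holds.zetaOrdinate_le_iff, Nat.add_one_le_iff]

/-- The number of indices `n` in a finite set with `a < γ_n ≤ a + 1` is at most `N(a+1) − N(a)`. [folklore] -/
theorem card_filter_window_le (s : Finset ℕ) (a : ℝ)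
    [DecidablePred fun n ↦ a < zetaOrdinate n ∧ zetaOrdinate n ≤ a + 1] :
    ((s.filter fun n ↦ a < zetaOrdinate n ∧ zetaOrdinate n ≤ a + 1).card : ℝ) ≤
      (zetaZeroCount (a + 1) : ℝ) - zetaZeroCount a := by
  have hsub : (s.filter fun n ↦ a < zetaOrdinate n ∧ zetaOrdinate n ≤ a + 1) ⊆
      Finset.Ico (zetaZeroCount a) (zetaZeroCount (a + 1)) := by
    intro n hn
    rw [Finset.mem_filter] at hn
    rw [Finset.mem_Ico]
    exact ⟨lt_zetaOrdinate_iff.1 hn.2.1, zetaOrdinate_le_iff_lt.1 hn.2.2⟩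
  have h := Finset.card_le_card hsub
  rw [Nat.card_Ico] at h
  have hmono : zetaZeroCount a ≤ zetaZeroCount (a + 1) := zetaZeroCount_mono (by linarith)
  rw [← Nat.cast_sub hmono]
  exact_mod_cast h

/-! ## Window sums of the Cauchy kernel over the ordinates -/

/-- **Zeros above a point.** If `N(u+1) − N(u) ≤ C₀ log(|u|+2)` for all `u`, then for `u₀, d ≥ 0`
and any finite set of indices `n` with `γ_n > u₀`,
`∑ 1/(1 + (γ_n − u₀ + d)²) ≤ C₀ (4 log(u₀+2) + 12 log(d+2))/(d+1)`
(group the zeros into the windows `(u₀+k, u₀+k+1]`, `k ≥ 0`). [folklore] -/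
theorem sum_above_le {C₀ : ℝ} (hC₀ : 0 ≤ C₀)
    (hW : ∀ u : ℝ, (zetaZeroCount (u + 1) : ℝ) - zetaZeroCount u ≤ C₀ * Real.log (|u| + 2))
    (s : Finset ℕ) {u₀ d : ℝ} (hu₀ : 0 ≤ u₀) (hd : 0 ≤ d) (hs : ∀ n ∈ s, u₀ < zetaOrdinate n) :
    ∑ n ∈ s, 1 / (1 + (zetaOrdinate n - u₀ + d) ^ 2) ≤
      C₀ * (4 * Real.log (u₀ + 2) + 12 * Real.log (d + 2)) / (d + 1) := by
  classical
  set key : ℕ → ℕ := fun n ↦ ⌈zetaOrdinate n - u₀⌉₊ - 1 with hkey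
  have hkey1 : ∀ n ∈ s, ((key n : ℕ) : ℝ) < zetaOrdinate n - u₀ ∧
      zetaOrdinate n - u₀ ≤ (key n : ℝ) + 1 := by
    intro n hn
    have hpos : 0 < zetaOrdinate n - u₀ := by linarith [hs n hn]
    have hc1 : 1 ≤ ⌈zetaOrdinate n - u₀⌉₊ := Nat.one_le_ceil_iff.2 hpos
    have hcast : ((key n : ℕ) : ℝ) = (⌈zetaOrdinate n - u₀⌉₊ : ℝ) - 1 := by
      simp only [hkey]
      rw [Nat.cast_sub hc1, Nat.cast_one]
    constructor
    · rw [hcast]; have := Nat.ceil_lt_add_one hpos.le; linarith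
    · rw [hcast]; have := Nat.le_ceil (zetaOrdinate n - u₀); linarith
  -- termwise bound
  have hterm : ∀ n ∈ s,
      1 / (1 + (zetaOrdinate n - u₀ + d) ^ 2) ≤ 1 / (1 + ((key n : ℝ) + d) ^ 2) := by
    intro n hn
    obtain ⟨h1, -⟩ := hkey1 n hn
    have h0 : 0 ≤ (key n : ℝ) + d := by positivity
    apply one_div_le_one_div_of_le (by positivity)
    nlinarith
  -- fibre cardinalities
  have hfib : ∀ k : ℕ, ((s.filter fun n ↦ key n = k).card : ℝ) ≤
      C₀ * (Real.log (u₀ + 2) + Real.log ((k : ℝ) + 1)) := by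
    intro k
    have hsub : (s.filter fun n ↦ key n = k) ⊆
        s.filter (fun n ↦ (u₀ + k) < zetaOrdinate n ∧ zetaOrdinate n ≤ (u₀ + k) + 1) := by
      intro n hn
      rw [Finset.mem_filter] at hn ⊢
      obtain ⟨hn1, hn2⟩ := hn
      obtain ⟨h1, h2⟩ := hkey1 n hn1
      rw [hn2] at h1 h2
      exact ⟨hn1, by linarith, by linarith⟩
    have hk0 : (0 : ℝ) ≤ u₀ + k := by positivity
    calc ((s.filter fun n ↦ key n = k).card : ℝ)
        ≤ ((s.filter (fun n ↦ (u₀ + k) < zetaOrdinate n ∧ zetaOrdinate n ≤ (u₀ + k) + 1)).card : ℝ) := by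
          exact_mod_cast Finset.card_le_card hsub
      _ ≤ (zetaZeroCount (u₀ + k + 1) : ℝ) - zetaZeroCount (u₀ + k) := card_filter_window_le _ _
      _ ≤ C₀ * Real.log (|u₀ + k| + 2) := hW _
      _ = C₀ * Real.log (u₀ + k + 2) := by rw [abs_of_nonneg hk0]
      _ ≤ C₀ * (Real.log (u₀ + 2) + Real.log ((k : ℝ) + 1)) := by
          refine mul_le_mul_of_nonneg_left ?_ hC₀
          rw [← Real.log_mul (by positivity) (by positivity)]
          exact Real.log_le_log (by positivity) (by nlinarith)
  -- bound the image of `key` by a range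
  set K : ℕ := (s.image key).sup id + 1 with hK
  have himg : s.image key ⊆ Finset.range K := by
    intro k hk
    rw [Finset.mem_range, hK, Nat.lt_add_one_iff]
    exact Finset.le_sup (f := id) hk
  have hlogu : 0 ≤ Real.log (u₀ + 2) := Real.log_nonneg (by linarith)
  calc ∑ n ∈ s, 1 / (1 + (zetaOrdinate n - u₀ + d) ^ 2)
      ≤ ∑ n ∈ s, 1 / (1 + ((key n : ℝ) + d) ^ 2) := Finset.sum_le_sum hterm
    _ = ∑ k ∈ s.image key, ((s.filter fun n ↦ key n = k).card : ℝ) * (1 / (1 + ((k : ℝ) + d) ^ 2)) := by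
        rw [Finset.sum_comp (fun k : ℕ ↦ (1 : ℝ) / (1 + ((k : ℝ) + d) ^ 2)) key]
        refine Finset.sum_congr rfl fun k _ ↦ ?_
        rw [nsmul_eq_mul]
    _ ≤ ∑ k ∈ s.image key, C₀ * (Real.log (u₀ + 2) + Real.log ((k : ℝ) + 1)) *
          (1 / (1 + ((k : ℝ) + d) ^ 2)) := by
        refine Finset.sum_le_sum fun k _ ↦ ?_
        exact mul_le_mul_of_nonneg_right (hfib k) (by positivity)
    _ ≤ ∑ k ∈ Finset.range K, C₀ * (Real.log (u₀ + 2) + Real.log ((k : ℝ) + 1)) *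
          (1 / (1 + ((k : ℝ) + d) ^ 2)) := by
        refine Finset.sum_le_sum_of_subset_of_nonneg himg fun k _ _ ↦ ?_
        have : 0 ≤ Real.log ((k : ℝ) + 1) := Real.log_nonneg (by linarith [k.cast_nonneg (α := ℝ)])
        positivity
    _ = C₀ * (Real.log (u₀ + 2) * ∑ k ∈ Finset.range K, 1 / (1 + ((k : ℝ) + d) ^ 2) +
          ∑ k ∈ Finset.range K, Real.log ((k : ℝ) + 1) / (1 + ((k : ℝ) + d) ^ 2)) := by
        rw [Finset.mul_sum, ← Finset.sum_add_distrib, Finset.mul_sum]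
        refine Finset.sum_congr rfl fun k _ ↦ ?_
        ring
    _ ≤ C₀ * (Real.log (u₀ + 2) * (4 / (d + 1)) + 12 * Real.log (d + 2) / (d + 1)) := by
        gcongr
        · exact sum_range_one_div_one_add_sq_le hd K
        · exact sum_range_log_div_one_add_sq_le hd K
    _ = C₀ * (4 * Real.log (u₀ + 2) + 12 * Real.log (d + 2)) / (d + 1) := by
        field_simp

/-- **Zeros below a point.** If `N(u+1) − N(u) ≤ C₀ log(|u|+2)` for all `u`, then for
`u₀, d ≥ 0` and any finite set of indices `n` with `γ_n ≤ u₀`,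
`∑ 1/(1 + (u₀ − γ_n + d)²) ≤ 8 C₀ log(u₀+2)/(d+1)`
(windows `(u₀−k−1, u₀−k]`, `0 ≤ k ≤ u₀`, each with `≤ C₀ log(u₀+3) ≤ 2C₀ log(u₀+2)` zeros). [folklore] -/
theorem sum_below_le {C₀ : ℝ} (hC₀ : 0 ≤ C₀)
    (hW : ∀ u : ℝ, (zetaZeroCount (u + 1) : ℝ) - zetaZeroCount u ≤ C₀ * Real.log (|u| + 2))
    (s : Finset ℕ) {u₀ d : ℝ} (hu₀ : 0 ≤ u₀) (hd : 0 ≤ d) (hs : ∀ n ∈ s, zetaOrdinate n ≤ u₀) :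
    ∑ n ∈ s, 1 / (1 + (u₀ - zetaOrdinate n + d) ^ 2) ≤ 8 * C₀ * Real.log (u₀ + 2) / (d + 1) := by
  classical
  set key : ℕ → ℕ := fun n ↦ ⌊u₀ - zetaOrdinate n⌋₊ with hkey
  have hkey1 : ∀ n ∈ s, ((key n : ℕ) : ℝ) ≤ u₀ - zetaOrdinate n ∧
      u₀ - zetaOrdinate n < (key n : ℝ) + 1 := by
    intro n hn
    have hnn : 0 ≤ u₀ - zetaOrdinate n := by linarith [hs n hn]
    exact ⟨Nat.floor_le hnn, Nat.lt_floor_add_one _⟩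
  have hterm : ∀ n ∈ s,
      1 / (1 + (u₀ - zetaOrdinate n + d) ^ 2) ≤ 1 / (1 + ((key n : ℝ) + d) ^ 2) := by
    intro n hn
    obtain ⟨h1, -⟩ := hkey1 n hn
    have h0 : 0 ≤ (key n : ℝ) + d := by positivity
    apply one_div_le_one_div_of_le (by positivity)
    nlinarith
  have hlog3 : Real.log (u₀ + 3) ≤ 2 * Real.log (u₀ + 2) := by
    have e : Real.log ((u₀ + 2) ^ 2) = 2 * Real.log (u₀ + 2) := by
      rw [Real.log_pow]; norm_num
    rw [← e]
    exact Real.log_le_log (by positivity) (by nlinarith)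
  have hfib : ∀ k : ℕ, ((s.filter fun n ↦ key n = k).card : ℝ) ≤ 2 * C₀ * Real.log (u₀ + 2) := by
    intro k
    by_cases hk : (k : ℝ) ≤ u₀
    · have hsub : (s.filter fun n ↦ key n = k) ⊆
          s.filter (fun n ↦ (u₀ - k - 1) < zetaOrdinate n ∧ zetaOrdinate n ≤ (u₀ - k - 1) + 1) := by
        intro n hn
        rw [Finset.mem_filter] at hn ⊢
        obtain ⟨hn1, hn2⟩ := hn
        obtain ⟨h1, h2⟩ := hkey1 n hn1
        rw [hn2] at h1 h2
        exact ⟨hn1, by linarith, by linarith⟩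
      calc ((s.filter fun n ↦ key n = k).card : ℝ)
          ≤ ((s.filter (fun n ↦ (u₀ - k - 1) < zetaOrdinate n ∧
              zetaOrdinate n ≤ (u₀ - k - 1) + 1)).card : ℝ) := by
            exact_mod_cast Finset.card_le_card hsub
        _ ≤ (zetaZeroCount (u₀ - k - 1 + 1) : ℝ) - zetaZeroCount (u₀ - k - 1) :=
            card_filter_window_le _ _
        _ ≤ C₀ * Real.log (|u₀ - k - 1| + 2) := hW _
        _ ≤ C₀ * Real.log (u₀ + 3) := by
            refine mul_le_mul_of_nonneg_left (Real.log_le_log (by positivity) ?_) hC₀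
            have : |u₀ - k - 1| ≤ u₀ + 1 := abs_le.2 ⟨by linarith [k.cast_nonneg (α := ℝ)], by
              linarith [k.cast_nonneg (α := ℝ)]⟩
            linarith
        _ ≤ 2 * C₀ * Real.log (u₀ + 2) := by nlinarith
    · -- no `n ∈ s` has `key n = k > u₀` (as `γ_n ≥ 0`)
      have hempty : (s.filter fun n ↦ key n = k) = ∅ := by
        rw [Finset.filter_eq_empty_iff]
        intro n hn hnk
        obtain ⟨h1, -⟩ := hkey1 n hn
        rw [hnk] at h1
        have := zetaOrdinate_nonneg n
        exact hk (by linarith)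
      rw [hempty, Finset.card_empty, Nat.cast_zero]
      have : 0 ≤ Real.log (u₀ + 2) := Real.log_nonneg (by linarith)
      positivity
  set K : ℕ := (s.image key).sup id + 1 with hK
  have himg : s.image key ⊆ Finset.range K := by
    intro k hk
    rw [Finset.mem_range, hK, Nat.lt_add_one_iff]
    exact Finset.le_sup (f := id) hk
  have hlogu : 0 ≤ Real.log (u₀ + 2) := Real.log_nonneg (by linarith)
  calc ∑ n ∈ s, 1 / (1 + (u₀ - zetaOrdinate n + d) ^ 2)
      ≤ ∑ n ∈ s, 1 / (1 + ((key n : ℝ) + d) ^ 2) := Finset.sum_le_sum hterm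
    _ = ∑ k ∈ s.image key, ((s.filter fun n ↦ key n = k).card : ℝ) * (1 / (1 + ((k : ℝ) + d) ^ 2)) := by
        rw [Finset.sum_comp (fun k : ℕ ↦ (1 : ℝ) / (1 + ((k : ℝ) + d) ^ 2)) key]
        refine Finset.sum_congr rfl fun k _ ↦ ?_
        rw [nsmul_eq_mul]
    _ ≤ ∑ k ∈ s.image key, 2 * C₀ * Real.log (u₀ + 2) * (1 / (1 + ((k : ℝ) + d) ^ 2)) := by
        refine Finset.sum_le_sum fun k _ ↦ ?_
        exact mul_le_mul_of_nonneg_right (hfib k) (by positivity)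
    _ ≤ ∑ k ∈ Finset.range K, 2 * C₀ * Real.log (u₀ + 2) * (1 / (1 + ((k : ℝ) + d) ^ 2)) := by
        refine Finset.sum_le_sum_of_subset_of_nonneg himg fun k _ _ ↦ by positivity
    _ = 2 * C₀ * Real.log (u₀ + 2) * ∑ k ∈ Finset.range K, 1 / (1 + ((k : ℝ) + d) ^ 2) := by
        rw [Finset.mul_sum]
    _ ≤ 2 * C₀ * Real.log (u₀ + 2) * (4 / (d + 1)) := by
        gcongr
        exact sum_range_one_div_one_add_sq_le hd K
    _ = 8 * C₀ * Real.log (u₀ + 2) / (d + 1) := by ring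

/-! ## Pointwise bounds for the kernel sums over the ordinates -/

/-- (KB1) For `0 ≤ t ≤ T`: `∑_{0<γ≤T} 1/(1+(t−γ)²) ≤ 24 C₀ log(T+2)` (zeros above `t` by
`sum_above_le`, zeros below `t` by `sum_below_le`, both with `d = 0`). [folklore] -/
theorem sum_range_kernel_le_of_mem_Icc {C₀ : ℝ} (hC₀ : 0 ≤ C₀)
    (hW : ∀ u : ℝ, (zetaZeroCount (u + 1) : ℝ) - zetaZeroCount u ≤ C₀ * Real.log (|u| + 2))
    {t T : ℝ} (ht : 0 ≤ t) (htT : t ≤ T) :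
    ∑ n ∈ Finset.range (zetaZeroCount T), 1 / (1 + (t - zetaOrdinate n) ^ 2) ≤
      24 * C₀ * Real.log (T + 2) := by
  classical
  rw [← Finset.sum_filter_add_sum_filter_not _ (fun n ↦ t < zetaOrdinate n)]
  set s₁ := (Finset.range (zetaZeroCount T)).filter (fun n ↦ t < zetaOrdinate n) with hs₁
  set s₂ := (Finset.range (zetaZeroCount T)).filter (fun n ↦ ¬ t < zetaOrdinate n) with hs₂
  have h1 : ∑ n ∈ s₁, 1 / (1 + (t - zetaOrdinate n) ^ 2) ≤
      C₀ * (4 * Real.log (t + 2) + 12 * Real.log (0 + 2)) / (0 + 1) := by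
    have key := sum_above_le hC₀ hW s₁ ht le_rfl (fun n hn ↦ (Finset.mem_filter.1 hn).2)
    refine le_trans (le_of_eq (Finset.sum_congr rfl fun n _ ↦ ?_)) key
    ring
  have h2 : ∑ n ∈ s₂, 1 / (1 + (t - zetaOrdinate n) ^ 2) ≤
      8 * C₀ * Real.log (t + 2) / (0 + 1) := by
    have key := sum_below_le hC₀ hW s₂ ht le_rfl (fun n hn ↦ not_lt.1 (Finset.mem_filter.1 hn).2)
    refine le_trans (le_of_eq (Finset.sum_congr rfl fun n _ ↦ ?_)) key
    ring
  simp only [zero_add, div_one] at h1 h2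
  have hlogt : Real.log (t + 2) ≤ Real.log (T + 2) := Real.log_le_log (by positivity) (by linarith)
  have hlog2 : Real.log 2 ≤ Real.log (T + 2) := Real.log_le_log (by positivity) (by linarith)
  have e1 := mul_le_mul_of_nonneg_left hlogt hC₀
  have e2 := mul_le_mul_of_nonneg_left hlog2 hC₀
  linarith

/-- (KB2a) For `0 ≤ t ≤ T`, the zeros above `T`:
`∑_{γ>T} 1/(1+(t−γ)²) ≤ 16 C₀ log(T+2)/(T−t+1)` (as a `tsum` over the indices `n ≥ N(T)`, i.e.
over `n + N(T)`; `sum_above_le` with `u₀ = T`, `d = T − t`). [folklore] -/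
theorem tsum_kernel_shift_le {C₀ : ℝ} (hC₀ : 0 ≤ C₀)
    (hW : ∀ u : ℝ, (zetaZeroCount (u + 1) : ℝ) - zetaZeroCount u ≤ C₀ * Real.log (|u| + 2))
    {t T : ℝ} (ht : 0 ≤ t) (htT : t ≤ T) :
    ∑' n : ℕ, 1 / (1 + (t - zetaOrdinate (n + zetaZeroCount T)) ^ 2) ≤
      16 * C₀ * Real.log (T + 2) / (T - t + 1) := by
  refine Real.tsum_le_of_sum_le (fun n ↦ by positivity) fun u ↦ ?_
  have hmap : ∑ n ∈ u, 1 / (1 + (t - zetaOrdinate (n + zetaZeroCount T)) ^ 2) =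
      ∑ m ∈ u.map (addRightEmbedding (zetaZeroCount T)), 1 / (1 + (t - zetaOrdinate m) ^ 2) := by
    rw [Finset.sum_map]
    rfl
  rw [hmap]
  set s := u.map (addRightEmbedding (zetaZeroCount T)) with hs_def
  have hs : ∀ m ∈ s, T < zetaOrdinate m := by
    intro m hm
    rw [hs_def, Finset.mem_map] at hm
    obtain ⟨n, -, rfl⟩ := hm
    exact lt_zetaOrdinate_iff.2 (by simp [addRightEmbedding])
  have key := sum_above_le hC₀ hW s (le_trans ht htT) (sub_nonneg.2 htT) hs
  have hlog : Real.log (T - t + 2) ≤ Real.log (T + 2) :=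
    Real.log_le_log (by linarith) (by linarith)
  have hlog0 : 0 ≤ Real.log (T + 2) := Real.log_nonneg (by linarith)
  calc ∑ m ∈ s, 1 / (1 + (t - zetaOrdinate m) ^ 2)
      = ∑ m ∈ s, 1 / (1 + (zetaOrdinate m - T + (T - t)) ^ 2) :=
        Finset.sum_congr rfl fun m _ ↦ by ring
    _ ≤ C₀ * (4 * Real.log (T + 2) + 12 * Real.log (T - t + 2)) / (T - t + 1) := key
    _ ≤ 16 * C₀ * Real.log (T + 2) / (T - t + 1) := by
        rw [div_le_div_iff_of_pos_right (by linarith)]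
        nlinarith [mul_le_mul_of_nonneg_left hlog hC₀]

/-- (KB2b) For `0 ≤ t ≤ T`, the zeros with negative ordinate:
`∑_{γ>0} 1/(1+(t+γ)²) ≤ 16 C₀ log(T+2)/(t+1)` (`sum_above_le` with `u₀ = 0`, `d = t`; all
ordinates are positive, `zetaOrdinate_pos_holds`). [folklore] -/
theorem tsum_kernel_neg_le {C₀ : ℝ} (hC₀ : 0 ≤ C₀)
    (hW : ∀ u : ℝ, (zetaZeroCount (u + 1) : ℝ) - zetaZeroCount u ≤ C₀ * Real.log (|u| + 2))
    {t T : ℝ} (ht : 0 ≤ t) (htT : t ≤ T) :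
    ∑' n : ℕ, 1 / (1 + (t + zetaOrdinate n) ^ 2) ≤ 16 * C₀ * Real.log (T + 2) / (t + 1) := by
  refine Real.tsum_le_of_sum_le (fun n ↦ by positivity) fun u ↦ ?_
  have hs : ∀ n ∈ u, (0 : ℝ) < zetaOrdinate n := fun n _ ↦ zetaOrdinate_pos_holds n
  have key := sum_above_le hC₀ hW u le_rfl ht hs
  have hlog : Real.log (t + 2) ≤ Real.log (T + 2) := Real.log_le_log (by linarith) (by linarith)
  have hlog2 : Real.log (0 + 2) ≤ Real.log (T + 2) := Real.log_le_log (by norm_num) (by linarith)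
  calc ∑ n ∈ u, 1 / (1 + (t + zetaOrdinate n) ^ 2)
      = ∑ n ∈ u, 1 / (1 + (zetaOrdinate n - 0 + t) ^ 2) :=
        Finset.sum_congr rfl fun n _ ↦ by ring
    _ ≤ C₀ * (4 * Real.log (0 + 2) + 12 * Real.log (t + 2)) / (t + 1) := key
    _ ≤ 16 * C₀ * Real.log (T + 2) / (t + 1) := by
        rw [div_le_div_iff_of_pos_right (by linarith)]
        nlinarith [mul_le_mul_of_nonneg_left hlog hC₀, mul_le_mul_of_nonneg_left hlog2 hC₀]

/-- (KB3) For `t ≥ T ≥ 0`: `∑_{0<γ≤T} 1/(1+(t−γ)²) ≤ 8 C₀ log(T+2)/(t−T+1)` (`sum_below_le` with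
`u₀ = T`, `d = t − T`). [folklore] -/
theorem sum_range_kernel_le_of_le {C₀ : ℝ} (hC₀ : 0 ≤ C₀)
    (hW : ∀ u : ℝ, (zetaZeroCount (u + 1) : ℝ) - zetaZeroCount u ≤ C₀ * Real.log (|u| + 2))
    {t T : ℝ} (hT : 0 ≤ T) (hTt : T ≤ t) :
    ∑ n ∈ Finset.range (zetaZeroCount T), 1 / (1 + (t - zetaOrdinate n) ^ 2) ≤
      8 * C₀ * Real.log (T + 2) / (t - T + 1) := by
  have hs : ∀ n ∈ Finset.range (zetaZeroCount T), zetaOrdinate n ≤ T :=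
    fun n hn ↦ zetaOrdinate_le_iff_lt.2 (Finset.mem_range.1 hn)
  have key := sum_below_le hC₀ hW _ hT (sub_nonneg.2 hTt) hs
  calc ∑ n ∈ Finset.range (zetaZeroCount T), 1 / (1 + (t - zetaOrdinate n) ^ 2)
      = ∑ n ∈ Finset.range (zetaZeroCount T), 1 / (1 + (T - zetaOrdinate n + (t - T)) ^ 2) :=
        Finset.sum_congr rfl fun n _ ↦ by ring
    _ ≤ 8 * C₀ * Real.log (T + 2) / (t - T + 1) := key

/-- (KB4) For `t ≤ 0` (and any `T`): `∑_{0<γ≤T} 1/(1+(t−γ)²) ≤ 16 C₀ log(|t|+2)/(|t|+1)`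
(`sum_above_le` with `u₀ = 0`, `d = |t|`). [folklore] -/
theorem sum_range_kernel_le_of_nonpos {C₀ : ℝ} (hC₀ : 0 ≤ C₀)
    (hW : ∀ u : ℝ, (zetaZeroCount (u + 1) : ℝ) - zetaZeroCount u ≤ C₀ * Real.log (|u| + 2))
    {t : ℝ} (ht : t ≤ 0) (T : ℝ) :
    ∑ n ∈ Finset.range (zetaZeroCount T), 1 / (1 + (t - zetaOrdinate n) ^ 2) ≤
      16 * C₀ * Real.log (|t| + 2) / (|t| + 1) := by
  have hs : ∀ n ∈ Finset.range (zetaZeroCount T), (0 : ℝ) < zetaOrdinate n :=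
    fun n _ ↦ zetaOrdinate_pos_holds n
  have habs : |t| = -t := abs_of_nonpos ht
  have key := sum_above_le hC₀ hW _ le_rfl (abs_nonneg t) hs
  have hlog2 : Real.log (0 + 2) ≤ Real.log (|t| + 2) :=
    Real.log_le_log (by norm_num) (by linarith [abs_nonneg t])
  calc ∑ n ∈ Finset.range (zetaZeroCount T), 1 / (1 + (t - zetaOrdinate n) ^ 2)
      = ∑ n ∈ Finset.range (zetaZeroCount T), 1 / (1 + (zetaOrdinate n - 0 + |t|) ^ 2) :=
        Finset.sum_congr rfl fun n _ ↦ by rw [habs]; ring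
    _ ≤ C₀ * (4 * Real.log (0 + 2) + 12 * Real.log (|t| + 2)) / (|t| + 1) := key
    _ ≤ 16 * C₀ * Real.log (|t| + 2) / (|t| + 1) := by
        rw [div_le_div_iff_of_pos_right (by positivity)]
        nlinarith [mul_le_mul_of_nonneg_left hlog2 hC₀]


end Montgomery

end Literature.NumberTheory.LFunctions
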